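import Summits.QuantumFields.BalabanUV.Beta.FP.OneShotKKTTorus
import Mathlib.LinearAlgebra.CrossProduct

/-!
# `BalabanUV.Beta.FP.TadpoleAdInvariance` — road «FP» for binder row D1, sub-row **GAMMA-0c (S4-AD), items (ii)+(iii)** (owner d1-p3-g7,
# journal 2026-08-21T01:16Z (E)): THE TADPOLE HYPOTHESIS `htad` OF `OneShotKKTTorus` IS DISCHARGED BY GLOBAL INVARIANCE + «NO INVARIANT COVECTOR»
# — an invariant functional has an invariant differential; a covector invariant under a group action without invariant covectors is zero

HONEST DEPENDENCY (cell records, verbatim): «continuum YM on T⁴ ⇐ BetaPertH ∧ nine spine estimates (0/9 proved); BetaPertH ⇐ (D1) ∧ (D4) ∧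
CAP+tail; G-an2-4 gates asym, D1 and NE2/3/4.»  HONEST FRAMING (cell contract, verbatim): «discharging `BetaPertH` makes Bałaban's UV stability
UNCONDITIONAL — a real constructive-QFT result; it is NOT the continuum limit and NOT the Clay problem.»  THIS MODULE is [folklore] one-variable
calculus (uniqueness of derivatives) and linear algebra over ABSTRACT data `Φ, Hf, Qf, ρ`; the invariance of the ROAD's families under global colour
rotations (the owner's «Ad-invariance») and the semisimplicity letter (i) over the road's colour table are NOT proved here — they enter as the
DISPLAYED hypotheses `hinv` ∕ `hno`; only the su(2) instance of (i) is proved, in Mathlib's cross-product currency, as a check.  NO estimate, NO lattice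
object, nothing of Bałaban's manuscripts, no definition, no `def … : Prop`, nothing cited, 0 sorry.  NOT D1, NOT BetaPertH, NOT continuum, NOT Clay.

ABSOLUTE RULE (cell charter, verbatim): «No internally-minted statement may enter as a cited fact. Every hypothesis is either kernel-proved in this
package or a verbatim quotation of a PUBLISHED theorem with page reference. The manuscript(s) under audit are NOT citable for their own disputed
steps — they are the thing under adjudication; programme-internal (2001/route/tribunal) claims are never citable.»

THE SUB-ROW (owner, verbatim core): «the road discharge of the displayed tadpole hypothesis `htad` of GAMMA-0 (a)∕(b) is NOT colour parity alone … but
GLOBAL COLOUR (Ad) INVARIANCE + SEMISIMPLICITY: (i) no Ad-invariant vector …; (ii) model: if the one-shot functional `Φ(V)` is invariant under a linear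
group action `ρ_g` … then `dΦ(0) ∘ ρ_g = dΦ(0)`, hence `dΦ(0) = 0` by (i); (iii) the same for the fine first variation `a ↦ −½tr(Γ∂_aΔ) − tr(𝓘∂_aQ)`
(the literal `htad` of p243953).»
CONTENT.
* §1 (ii) `deriv_line_eq_of_invariant` (line form: `Φ(x₀ + s•w′) = Φ(x₀ + s•w) + c` ⟹ equal line-derivatives at `0`; the constant `c` allows
  equivariance with merely invertible conjugators, which shifts `log|det kkt|` by a constant), `fderiv_comp_eq_of_invariant` (Fréchet form:
  `Φ ∘ ρ = Φ + c`, `ρ` linear ⟹ `dΦ(0) ∘L ρ = dΦ(0)`).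
* §2 (i)-as-a-letter: `eq_zero_of_noInvariantCovector` (bookkeeping) and the su(2) CHECK `eq_zero_of_dotProduct_cross_eq_zero`: a covector on
  `ℝ³ ≅ su(2)` killing all brackets `v ⨯₃ w` is zero (perfectness).
* §3 (iii) `hasDerivAt_oneShot_line` — the line-derivative of `−½log|det kkt(Hf, Qf)|` at `x₀` in direction `w` IS the tadpole
  `tad w = −½tr(Γ·of(dHf₀ w)) − tr(𝓘·of(dQf₀ w))` of `OneShotKKTTorus`; `tadpole_add`, `tadpole_smul`; **`tadpole_eq_of_invariant`**;
  **`tadpole_eq_zero_of_noInvariantCovector`** — `htad` DISCHARGED from `hinv` + `hno`.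
Provenance: D1 formalisation swarm leaf seat `b2b-balaban-beta-d1-formalise-leaf-05` gen 11 (sub-row GAMMA-0c, first refusal, INTENT journal
2026-08-21T01:18Z), 2026-08-21.
-/

noncomputable section

namespace Summit.QuantumFields.BalabanUV.Beta.FP.TadpoleAdInvariance

open Matrix Filter Topology
open Literature.MathematicalPhysics.QuantumFieldTheory.Balaban1983to89.Beta.Composition (kkt)
open Literature.MathematicalPhysics.QuantumFieldTheory.Balaban1983to89.Beta.CompositionSingular (flucCov minOp)
open Summit.QuantumFields.BalabanUV.Beta.FP.KKTSecondVariation (hasDerivAt_negHalfLogAbsDet_kkt)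
open Summit.QuantumFields.BalabanUV.Beta.FP.OneShotKKTTorus (hasDerivAt_comp_line)

/-! ## §1 (ii) An invariant functional has an invariant differential -/

section Invariance

variable {E : Type*} [NormedAddCommGroup E] [NormedSpace ℝ E]

/-- [folklore] LINE FORM.  If `Φ(x₀ + s•w′) = Φ(x₀ + s•w) + c` for all `s` (invariance of the functional up to an additive constant along the two
lines) and the two line functions have derivatives `T`, `T′` at `0`, then `T′ = T`. -/
theorem deriv_line_eq_of_invariant {Φ : E → ℝ} {x₀ w w' : E} {c T T' : ℝ} (hinv : ∀ s : ℝ, Φ (x₀ + s • w') = Φ (x₀ + s • w) + c)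
    (hT : HasDerivAt (fun s : ℝ => Φ (x₀ + s • w)) T 0) (hT' : HasDerivAt (fun s : ℝ => Φ (x₀ + s • w')) T' 0) : T' = T := by
  have h : HasDerivAt (fun s : ℝ => Φ (x₀ + s • w')) T 0 := by
    have := hT.add_const c
    refine this.congr_of_eventuallyEq (Eventually.of_forall fun s => ?_)
    exact hinv s
  exact hT'.unique h

/-- [folklore] FRÉCHET FORM.  If `Φ (ρ v) = Φ v + c` for all `v` with `ρ` continuous linear and `Φ` has Fréchet derivative `ℓ` at `0`, then
`ℓ ∘L ρ = ℓ` («`dΦ(0) ∘ ρ_g = dΦ(0)`»). -/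
theorem fderiv_comp_eq_of_invariant {Φ : E → ℝ} {ρ : E →L[ℝ] E} {c : ℝ} {ℓ : E →L[ℝ] ℝ} (hinv : ∀ v, Φ (ρ v) = Φ v + c)
    (hΦ : HasFDerivAt Φ ℓ 0) : ℓ.comp ρ = ℓ := by
  have h0 : ρ 0 = 0 := map_zero ρ
  have hΦ' : HasFDerivAt Φ ℓ (ρ 0) := by rw [h0]; exact hΦ
  have h1 : HasFDerivAt (fun v => Φ (ρ v)) (ℓ.comp ρ) 0 := hΦ'.comp 0 ρ.hasFDerivAt
  have h2 : HasFDerivAt (fun v => Φ (ρ v)) ℓ 0 := by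
    refine (hΦ.add_const c).congr_of_eventuallyEq (Eventually.of_forall fun v => ?_)
    exact hinv v
  exact h1.unique h2

end Invariance

/-! ## §2 (i) as a letter: no invariant covector ⟹ zero; the su(2) check -/

section NoInvariant

variable {E : Type*} {G : Type*}

/-- [folklore] BOOKKEEPING.  If every additive, homogeneous, `ρ`-invariant real functional on `E` vanishes (the «no invariant covector» letter — on
the road: Ad-invariance + semisimplicity of the colour algebra, item (i)) and `T` is such a functional, then `T w = 0` for every `w`. -/
theorem eq_zero_of_noInvariantCovector [AddCommGroup E] [Module ℝ E] (ρ : G → E → E) {T : E → ℝ}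
    (hno : ∀ T : E → ℝ, (∀ w w', T (w + w') = T w + T w') → (∀ (r : ℝ) w, T (r • w) = r * T w) → (∀ g w, T (ρ g w) = T w) → ∀ w, T w = 0)
    (hadd : ∀ w w', T (w + w') = T w + T w') (hsmul : ∀ (r : ℝ) w, T (r • w) = r * T w) (hinv : ∀ g w, T (ρ g w) = T w) (w : E) :
    T w = 0 :=
  hno T hadd hsmul hinv w

/-- [folklore] THE su(2) CHECK of letter (i), in Mathlib's cross-product currency (`(ℝ³, ⨯₃) ≅ su(2)`): a covector killing every bracket is zero —
`(∀ v w, x ⬝ᵥ (v ⨯₃ w) = 0) → x = 0` (perfectness `[𝔤, 𝔤] = 𝔤`). -/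
theorem eq_zero_of_dotProduct_cross_eq_zero (x : Fin 3 → ℝ) (h : ∀ v w : Fin 3 → ℝ, x ⬝ᵥ (v ⨯₃ w) = 0) : x = 0 := by
  have h0 := h ![0, 1, 0] ![0, 0, 1]
  have h1 := h ![0, 0, 1] ![1, 0, 0]
  have h2 := h ![1, 0, 0] ![0, 1, 0]
  simp only [cross_apply, dotProduct, Fin.sum_univ_three, Matrix.cons_val_zero, Matrix.cons_val_one, Matrix.cons_val_two,
    Matrix.head_cons, Matrix.tail_cons, mul_one, mul_zero, sub_zero, add_zero, zero_add] at h0 h1 h2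
  funext i
  fin_cases i
  · simpa using h0
  · simpa using h1
  · simpa using h2

end NoInvariant

/-! ## §3 (iii) The literal tadpole of `OneShotKKTTorus` -/

section Tadpole

variable {κ ν ρ : Type*} [Fintype κ] [Fintype ν] [Fintype ρ] [DecidableEq ν] [DecidableEq ρ]

/-- [folklore] **THE TADPOLE IS THE LINE-DERIVATIVE OF THE ONE SHOT.**  With `HasFDerivAt Hf dHf₀ x₀`, `HasFDerivAt Qf dQf₀ x₀`, `Hf x₀` symmetric and
`det kkt ≠ 0` at `x₀`, the function `s ↦ −½log|det kkt(Hf(x₀ + s•w), Qf(x₀ + s•w))|` has derivative at `0` the tadpole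
`−½tr(Γ·of(dHf₀ w)) − tr(𝓘·of(dQf₀ w))` (`Γ, 𝓘` the blocks of `(kkt (Hf x₀) (Qf x₀))⁻¹`) — the `htad` functional of
`OneShotKKTTorus.hasDerivAt_oneShot_comp_curve_of_tadpole_eq_zero`. -/
theorem hasDerivAt_oneShot_line {Hf : (κ → ℝ) → ν → ν → ℝ} {dHf₀ : (κ → ℝ) →L[ℝ] (ν → ν → ℝ)} {Qf : (κ → ℝ) → ρ → ν → ℝ}
    {dQf₀ : (κ → ℝ) →L[ℝ] (ρ → ν → ℝ)} {x₀ : κ → ℝ} (hH : HasFDerivAt Hf dHf₀ x₀) (hQ : HasFDerivAt Qf dQf₀ x₀)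
    (hsym : (Matrix.of (Hf x₀))ᵀ = Matrix.of (Hf x₀)) (hdet : (kkt (Matrix.of (Hf x₀)) (Matrix.of (Qf x₀))).det ≠ 0) (w : κ → ℝ) :
    HasDerivAt (fun s : ℝ => -(1 / 2 : ℝ) * Real.log |(kkt (Matrix.of (Hf (x₀ + s • w))) (Matrix.of (Qf (x₀ + s • w)))).det|)
      (-(1 / 2 : ℝ) * (flucCov (Matrix.of (Hf x₀)) (Matrix.of (Qf x₀)) * Matrix.of (dHf₀ w)).trace
        - (minOp (Matrix.of (Hf x₀)) (Matrix.of (Qf x₀)) * Matrix.of (dQf₀ w)).trace) 0 := by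
  have hHl : HasDerivAt (fun s : ℝ => Hf (x₀ + s • w)) (Matrix.of.symm (Matrix.of (dHf₀ w))) 0 := hasDerivAt_comp_line hH w
  have hQl : HasDerivAt (fun s : ℝ => Qf (x₀ + s • w)) (Matrix.of.symm (Matrix.of (dQf₀ w))) 0 := hasDerivAt_comp_line hQ w
  have h0 : x₀ + (0 : ℝ) • w = x₀ := by rw [zero_smul, add_zero]
  have hsym' : (Matrix.of (Hf (x₀ + (0 : ℝ) • w)))ᵀ = Matrix.of (Hf (x₀ + (0 : ℝ) • w)) := by rw [h0]; exact hsym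
  have hdet' : (kkt (Matrix.of (Hf (x₀ + (0 : ℝ) • w))) (Matrix.of (Qf (x₀ + (0 : ℝ) • w)))).det ≠ 0 := by rw [h0]; exact hdet
  have h := hasDerivAt_negHalfLogAbsDet_kkt (H := fun s : ℝ => Hf (x₀ + s • w)) (Q := fun s : ℝ => Qf (x₀ + s • w)) hHl hQl hsym' hdet'
  simp only [h0] at h
  exact h

omit [Fintype κ] [DecidableEq ν] [DecidableEq ρ] in
/-- [folklore] The tadpole is ADDITIVE in the direction. -/
theorem tadpole_add (Γ : Matrix ν ν ℝ) (I : Matrix ν ρ ℝ) (dHf₀ : (κ → ℝ) →L[ℝ] (ν → ν → ℝ)) (dQf₀ : (κ → ℝ) →L[ℝ] (ρ → ν → ℝ))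
    (w w' : κ → ℝ) :
    -(1 / 2 : ℝ) * (Γ * Matrix.of (dHf₀ (w + w'))).trace - (I * Matrix.of (dQf₀ (w + w'))).trace
      = (-(1 / 2 : ℝ) * (Γ * Matrix.of (dHf₀ w)).trace - (I * Matrix.of (dQf₀ w)).trace)
        + (-(1 / 2 : ℝ) * (Γ * Matrix.of (dHf₀ w')).trace - (I * Matrix.of (dQf₀ w')).trace) := by
  have e1 : Matrix.of (dHf₀ (w + w')) = Matrix.of (dHf₀ w) + Matrix.of (dHf₀ w') := by rw [dHf₀.map_add]; rfl
  have e2 : Matrix.of (dQf₀ (w + w')) = Matrix.of (dQf₀ w) + Matrix.of (dQf₀ w') := by rw [dQf₀.map_add]; rfl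
  rw [e1, e2, Matrix.mul_add, Matrix.mul_add, Matrix.trace_add, Matrix.trace_add]
  ring

omit [Fintype κ] [DecidableEq ν] [DecidableEq ρ] in
/-- [folklore] The tadpole is HOMOGENEOUS in the direction. -/
theorem tadpole_smul (Γ : Matrix ν ν ℝ) (I : Matrix ν ρ ℝ) (dHf₀ : (κ → ℝ) →L[ℝ] (ν → ν → ℝ)) (dQf₀ : (κ → ℝ) →L[ℝ] (ρ → ν → ℝ))
    (r : ℝ) (w : κ → ℝ) :
    -(1 / 2 : ℝ) * (Γ * Matrix.of (dHf₀ (r • w))).trace - (I * Matrix.of (dQf₀ (r • w))).trace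
      = r * (-(1 / 2 : ℝ) * (Γ * Matrix.of (dHf₀ w)).trace - (I * Matrix.of (dQf₀ w)).trace) := by
  have e1 : Matrix.of (dHf₀ (r • w)) = r • Matrix.of (dHf₀ w) := by rw [dHf₀.map_smul]; rfl
  have e2 : Matrix.of (dQf₀ (r • w)) = r • Matrix.of (dQf₀ w) := by rw [dQf₀.map_smul]; rfl
  rw [e1, e2, Matrix.mul_smul, Matrix.mul_smul, Matrix.trace_smul, Matrix.trace_smul, smul_eq_mul, smul_eq_mul]
  ring

/-- [folklore] **INVARIANCE OF THE ONE SHOT ⟹ INVARIANCE OF THE TADPOLE.**  If the one-shot functional takes the same values, up to an additive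
constant, along the lines through `x₀` in the directions `w` and `w′` (on the road: `w′ = ρ_g w` for a global colour rotation `g`, by equivariance of
`H_cov`, `Q` with invertible conjugators), then the tadpoles agree: `tad w′ = tad w`. -/
theorem tadpole_eq_of_invariant {Hf : (κ → ℝ) → ν → ν → ℝ} {dHf₀ : (κ → ℝ) →L[ℝ] (ν → ν → ℝ)} {Qf : (κ → ℝ) → ρ → ν → ℝ}
    {dQf₀ : (κ → ℝ) →L[ℝ] (ρ → ν → ℝ)} {x₀ : κ → ℝ} (hH : HasFDerivAt Hf dHf₀ x₀) (hQ : HasFDerivAt Qf dQf₀ x₀)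
    (hsym : (Matrix.of (Hf x₀))ᵀ = Matrix.of (Hf x₀)) (hdet : (kkt (Matrix.of (Hf x₀)) (Matrix.of (Qf x₀))).det ≠ 0) {w w' : κ → ℝ} {c : ℝ}
    (hinv : ∀ s : ℝ, -(1 / 2 : ℝ) * Real.log |(kkt (Matrix.of (Hf (x₀ + s • w'))) (Matrix.of (Qf (x₀ + s • w')))).det|
      = -(1 / 2 : ℝ) * Real.log |(kkt (Matrix.of (Hf (x₀ + s • w))) (Matrix.of (Qf (x₀ + s • w)))).det| + c) :
    -(1 / 2 : ℝ) * (flucCov (Matrix.of (Hf x₀)) (Matrix.of (Qf x₀)) * Matrix.of (dHf₀ w')).trace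
        - (minOp (Matrix.of (Hf x₀)) (Matrix.of (Qf x₀)) * Matrix.of (dQf₀ w')).trace
      = -(1 / 2 : ℝ) * (flucCov (Matrix.of (Hf x₀)) (Matrix.of (Qf x₀)) * Matrix.of (dHf₀ w)).trace
        - (minOp (Matrix.of (Hf x₀)) (Matrix.of (Qf x₀)) * Matrix.of (dQf₀ w)).trace :=
  deriv_line_eq_of_invariant
    (Φ := fun x => -(1 / 2 : ℝ) * Real.log |(kkt (Matrix.of (Hf x)) (Matrix.of (Qf x))).det|) hinv
    (hasDerivAt_oneShot_line hH hQ hsym hdet w) (hasDerivAt_oneShot_line hH hQ hsym hdet w')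

/-- [folklore] **`htad` DISCHARGED AT MODEL LEVEL** (sub-row GAMMA-0c (ii)+(iii)).  If the one-shot functional is invariant up to additive constants
under a family `ρg` of maps of the fine directions (`hinv`, for every `g` and `w`) and the fine space carries NO non-zero additive homogeneous
`ρg`-invariant real functional (`hno` — on the road: global colour Ad-invariance + semisimplicity, item (i)), then the tadpole vanishes in EVERY
direction: `−½tr(Γ·of(dHf₀ w)) − tr(𝓘·of(dQf₀ w)) = 0` — the hypothesis `htad` of `OneShotKKTTorus.hasDerivAt_oneShot_comp_curve_of_tadpole_eq_zero`. -/
theorem tadpole_eq_zero_of_noInvariantCovector {G : Type*} {Hf : (κ → ℝ) → ν → ν → ℝ} {dHf₀ : (κ → ℝ) →L[ℝ] (ν → ν → ℝ)}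
    {Qf : (κ → ℝ) → ρ → ν → ℝ} {dQf₀ : (κ → ℝ) →L[ℝ] (ρ → ν → ℝ)} {x₀ : κ → ℝ} (hH : HasFDerivAt Hf dHf₀ x₀) (hQ : HasFDerivAt Qf dQf₀ x₀)
    (hsym : (Matrix.of (Hf x₀))ᵀ = Matrix.of (Hf x₀)) (hdet : (kkt (Matrix.of (Hf x₀)) (Matrix.of (Qf x₀))).det ≠ 0)
    (ρg : G → (κ → ℝ) → (κ → ℝ)) (c : G → (κ → ℝ) → ℝ)
    (hinv : ∀ g w (s : ℝ), -(1 / 2 : ℝ) * Real.log |(kkt (Matrix.of (Hf (x₀ + s • ρg g w))) (Matrix.of (Qf (x₀ + s • ρg g w)))).det|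
      = -(1 / 2 : ℝ) * Real.log |(kkt (Matrix.of (Hf (x₀ + s • w))) (Matrix.of (Qf (x₀ + s • w)))).det| + c g w)
    (hno : ∀ T : (κ → ℝ) → ℝ, (∀ w w', T (w + w') = T w + T w') → (∀ (r : ℝ) w, T (r • w) = r * T w) →
      (∀ g w, T (ρg g w) = T w) → ∀ w, T w = 0)
    (w : κ → ℝ) :
    -(1 / 2 : ℝ) * (flucCov (Matrix.of (Hf x₀)) (Matrix.of (Qf x₀)) * Matrix.of (dHf₀ w)).trace
        - (minOp (Matrix.of (Hf x₀)) (Matrix.of (Qf x₀)) * Matrix.of (dQf₀ w)).trace = 0 :=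
  eq_zero_of_noInvariantCovector ρg
    (T := fun w => -(1 / 2 : ℝ) * (flucCov (Matrix.of (Hf x₀)) (Matrix.of (Qf x₀)) * Matrix.of (dHf₀ w)).trace
      - (minOp (Matrix.of (Hf x₀)) (Matrix.of (Qf x₀)) * Matrix.of (dQf₀ w)).trace)
    hno (tadpole_add _ _ dHf₀ dQf₀) (tadpole_smul _ _ dHf₀ dQf₀)
    (fun g w => tadpole_eq_of_invariant hH hQ hsym hdet (hinv g w)) w

end Tadpole

end Summit.QuantumFields.BalabanUV.Beta.FP.TadpoleAdInvariance

end
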